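import Summits.CriticalPhenomena.SAWScalingLimit.Theorems.SAWDevelopingMapInteriorFlatteningLiouvilleDefs
import Summits.CriticalPhenomena.SAWScalingLimit.Theorems.SAWDevelopingMapInteriorFlatteningSpinDictionary
import Summits.CriticalPhenomena.SAWScalingLimit.Theorems.SAWDevelopingMapObservableToSLECanonicalTransferLatticePaths

/-!
# Lattice Harnack chains for the crux `InteriorFlattening` (helper B for the stub
`stub_compactnessAtOrigin`, line `liouville-local-limits`, stmt-CriticalPhenomena-8297)

Under the bulk no-fold bound `RatioAtDepth R₀ k` with `k < 1`, the three ports of the DCS observable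
at a deep vertex `v` of a simply connected domain with a boundary root are comparable with the
monopole `M(v)` and with each other (`port_bounds_of_star`, `norm_port_le_of_adj`): DCS's Lemma 1
makes the counter-clockwise `ℤ/3`-mode vanish (`bel_eq_zero_of_ccw` of `…SpinDictionary`, one of the
two labellings of every star is counter-clockwise, `hexStar_directions`), and together with the
Beltrami bound `‖B‖ ≤ k‖M‖` the inverse `ℤ/3`-Fourier transform `3Fⱼ = M + ωʲ' B` pins every port:
`(1-k)‖M‖ ≤ 3‖Fⱼ‖ ≤ (1+k)‖M‖` (`modes_bounds`). Chained along a lattice walk from the origin vertex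
`O` (`exists_walk_dist_le_dist`) this bounds every coordinate of the `M(O)`-normalised field by a
constant depending on the edge only, as soon as the configuration is deep enough at `O`
(`harnack_walk`, `harnack_edge`) — the local boundedness feeding the diagonal extraction of
`stub_compactnessAtOrigin`.
-/

noncomputable section

open scoped BigOperators Topology
open Filter Literature.Probability.LatticeModels Literature.Probability.RandomPlanarGeometry.SAW

namespace Summit.CriticalPhenomena.SAWScalingLimit.Theorems.InteriorFlattening.Liouville.Compactness

/-! ### The cube root of unity -/

/-- `ω = ζ²` (`ζ = e^{iπ/3}`). -/
theorem omega_eq_triZeta_sq : omega = triZeta ^ 2 := OneMouth.cexp_two_pi_I_div_three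

/-- `1 + ω + ω² = 0`. -/
theorem one_add_omega_add_sq : 1 + omega + omega ^ 2 = 0 := by
  rw [omega_eq_triZeta_sq]
  linear_combination (triZeta ^ 2 + triZeta + 1) * triZeta_sq

/-- `ω³ = 1`. -/
theorem omega_pow_three : omega ^ 3 = 1 := by
  rw [omega_eq_triZeta_sq, ← pow_mul]
  exact triZeta_pow_six

/-- `‖ω‖ = 1`. -/
theorem norm_omega : ‖omega‖ = 1 := by
  rw [omega_eq_triZeta_sq, norm_pow, ← Real.sqrt_sq (norm_nonneg triZeta), Complex.sq_norm,
    normSq_triZeta]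
  simp

/-! ### The inverse `ℤ/3`-Fourier transform at a vertex with vanishing DCS mode -/

/-- **Local Harnack algebra.** For ANY lattice field, at a vertex where the `ω`-combination of the
labelling `(w₀, w₁, w₂)` vanishes (Lemma 1 for a counter-clockwise labelling) and the Beltrami
quotient of the mirrored labelling `(w₀, w₂, w₁)` is at most `k`, every port is pinned to the
monopole: `3‖Fⱼ‖ ≤ (1+k)‖M‖` and `(1-k)‖M‖ ≤ 3‖Fⱼ‖` (`3Fⱼ = M + ωʲ' B`). -/
theorem modes_bounds (G : Sym2 HexVertex → ℂ) (v w₀ w₁ w₂ : HexVertex) (k : ℝ)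
    (hD : fieldBelt G v w₀ w₁ w₂ = 0)
    (hB : ‖fieldBelt G v w₀ w₂ w₁‖ ≤ k * ‖fieldMono G v w₀ w₂ w₁‖) :
    (3 * ‖G s(v, w₀)‖ ≤ (1 + k) * ‖fieldMono G v w₀ w₁ w₂‖ ∧
      3 * ‖G s(v, w₁)‖ ≤ (1 + k) * ‖fieldMono G v w₀ w₁ w₂‖ ∧
      3 * ‖G s(v, w₂)‖ ≤ (1 + k) * ‖fieldMono G v w₀ w₁ w₂‖) ∧
    ((1 - k) * ‖fieldMono G v w₀ w₁ w₂‖ ≤ 3 * ‖G s(v, w₀)‖ ∧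
      (1 - k) * ‖fieldMono G v w₀ w₁ w₂‖ ≤ 3 * ‖G s(v, w₁)‖ ∧
      (1 - k) * ‖fieldMono G v w₀ w₁ w₂‖ ≤ 3 * ‖G s(v, w₂)‖) := by
  set F0 := G s(v, w₀) with hF0
  set F1 := G s(v, w₁) with hF1
  set F2 := G s(v, w₂) with hF2
  have hM : fieldMono G v w₀ w₁ w₂ = F0 + F1 + F2 := rfl
  have hM' : fieldMono G v w₀ w₂ w₁ = fieldMono G v w₀ w₁ w₂ := by
    simp only [fieldMono]; ring
  have hBd : fieldBelt G v w₀ w₂ w₁ = F0 + omega * F2 + omega ^ 2 * F1 := rfl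
  have hDd : F0 + omega * F1 + omega ^ 2 * F2 = 0 := hD
  rw [hM'] at hB
  set M := fieldMono G v w₀ w₁ w₂ with hMdef
  set B := fieldBelt G v w₀ w₂ w₁ with hBdef
  have h1 := one_add_omega_add_sq
  -- inverse ℤ/3-DFT
  have e0 : (3 : ℂ) * F0 = M + B := by
    rw [hM, hBd]; linear_combination hDd - (F1 + F2) * h1
  have e1 : (3 : ℂ) * F1 = M + omega * B := by
    rw [hM, hBd]
    linear_combination (-(1 + omega)) * hDd + ((2 - omega) * F1 + (omega - 1) * F2) * h1
  have e2 : (3 : ℂ) * F2 = M + omega ^ 2 * B := by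
    rw [hM, hBd]
    linear_combination (-(1 + omega ^ 2)) * hDd +
      (-(omega - 1) ^ 2 * F1 + (omega ^ 2 - 2 * omega + 2) * F2) * h1
  have h3n : ‖(3 : ℂ)‖ = 3 := by norm_num
  have hω1 : ‖omega‖ = 1 := norm_omega
  have hω2 : ‖omega ^ 2‖ = 1 := by rw [norm_pow, norm_omega, one_pow]
  -- generic step
  have key : ∀ (F u : ℂ), ‖u‖ = 1 → (3 : ℂ) * F = M + u * B →
      3 * ‖F‖ ≤ (1 + k) * ‖M‖ ∧ (1 - k) * ‖M‖ ≤ 3 * ‖F‖ := by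
    intro F u hu hF
    have huB : ‖u * B‖ = ‖B‖ := by rw [norm_mul, hu, one_mul]
    have n0 : 3 * ‖F‖ ≤ ‖M‖ + ‖B‖ := by
      calc 3 * ‖F‖ = ‖(3 : ℂ) * F‖ := by rw [norm_mul, h3n]
        _ = ‖M + u * B‖ := by rw [hF]
        _ ≤ ‖M‖ + ‖u * B‖ := norm_add_le _ _
        _ = ‖M‖ + ‖B‖ := by rw [huB]
    have n1 : ‖M‖ ≤ 3 * ‖F‖ + ‖B‖ := by
      have hMeq : M = 3 * F - u * B := by linear_combination (-1 : ℂ) * hF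
      calc ‖M‖ = ‖(3 : ℂ) * F - u * B‖ := by rw [← hMeq]
        _ ≤ ‖(3 : ℂ) * F‖ + ‖u * B‖ := norm_sub_le _ _
        _ = 3 * ‖F‖ + ‖B‖ := by rw [norm_mul, h3n, huB]
    constructor <;> nlinarith [hB, n0, n1, norm_nonneg M, norm_nonneg B]
  have k0 := key F0 1 (by simp) (by rw [one_mul]; exact e0)
  have k1 := key F1 omega hω1 e1
  have k2 := key F2 (omega ^ 2) hω2 e2
  exact ⟨⟨k0.1, k1.1, k2.1⟩, ⟨k0.2, k1.2, k2.2⟩⟩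

/-! ### Stars of the honeycomb lattice -/

/-- **The star of a vertex**: given one neighbour `q` of `p`, the other two, with the complete
list of neighbours of `p`. -/
theorem star_cases {p q : HexVertex} (h : hexGraph.Adj p q) :
    ∃ q₁ q₂ : HexVertex, hexGraph.Adj p q₁ ∧ hexGraph.Adj p q₂ ∧ q ≠ q₁ ∧ q₁ ≠ q₂ ∧ q ≠ q₂ ∧
      ∀ w : HexVertex, hexGraph.Adj p w → w = q ∨ w = q₁ ∨ w = q₂ := by
  obtain ⟨x, y, z, hxy, hxz, hyz, hs⟩ := Set.ncard_eq_three.1 (card_neighborSet_hexGraph_holds p)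
  have hmem : ∀ w, hexGraph.Adj p w ↔ w = x ∨ w = y ∨ w = z := fun w => by
    rw [← SimpleGraph.mem_neighborSet, hs]
    simp
  rcases (hmem q).1 h with rfl | rfl | rfl
  · exact ⟨y, z, (hmem y).2 (Or.inr (Or.inl rfl)), (hmem z).2 (Or.inr (Or.inr rfl)), hxy, hyz, hxz,
      fun w hw => (hmem w).1 hw⟩
  · refine ⟨x, z, (hmem x).2 (Or.inl rfl), (hmem z).2 (Or.inr (Or.inr rfl)), Ne.symm hxy, hxz, hyz,
      fun w hw => ?_⟩
    rcases (hmem w).1 hw with e | e | e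
    · exact Or.inr (Or.inl e)
    · exact Or.inl e
    · exact Or.inr (Or.inr e)
  · refine ⟨x, y, (hmem x).2 (Or.inl rfl), (hmem y).2 (Or.inr (Or.inl rfl)), Ne.symm hxz, hxy,
      Ne.symm hyz, fun w hw => ?_⟩
    rcases (hmem w).1 hw with e | e | e
    · exact Or.inr (Or.inl e)
    · exact Or.inr (Or.inr e)
    · exact Or.inl e

/-! ### Lemma 1 at a deep vertex: one chirality of every star has vanishing mode -/

/-- **DCS Lemma 1 in mode form, both chiralities**: for a simply connected `Λ`, a boundary root
`a` and `v ∈ Λ`, every labelled star at `v` has the `ω`-combination of the observable vanishing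
for ONE of its two chiralities `(w₀, w₁, w₂)`, `(w₀, w₂, w₁)` (the counter-clockwise one). -/
theorem belt_eq_zero_or {Λ : Finset HexVertex} {a : Sym2 HexVertex} {v w₀ w₁ w₂ : HexVertex}
    (hΛ : hexDomainSimplyConnected Λ) (ha : a ∈ hexDomainBoundary Λ) (hv : v ∈ Λ)
    (h₀ : hexGraph.Adj v w₀) (h₁ : hexGraph.Adj v w₁) (h₂ : hexGraph.Adj v w₂) (h01 : w₀ ≠ w₁)
    (h12 : w₁ ≠ w₂) (h02 : w₀ ≠ w₂) :
    fieldBelt (obs Λ a) v w₀ w₁ w₂ = 0 ∨ fieldBelt (obs Λ a) v w₀ w₂ w₁ = 0 := by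
  obtain ⟨he, u, c₀, rfl, hc₀, hu⟩ := ha
  have huc : hexGraph.Adj u c₀ := (SimpleGraph.mem_edgeSet _).1 he
  rcases hexStar_directions h₀ h₁ h₂ h01 h12 h02 with ⟨hd₁, hd₂⟩ | ⟨hd₁, hd₂⟩
  · exact Or.inl (OneMouth.bel_eq_zero_of_ccw hΛ hu hc₀ huc hv ⟨h₀, h₁, h₂, h01, h12, h02⟩ hd₁ hd₂)
  · exact Or.inr (OneMouth.bel_eq_zero_of_ccw hΛ hu hc₀ huc hv
      ⟨h₀, h₂, h₁, h02, h12.symm, h01⟩ hd₂ hd₁)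

/-- **Port bounds at a deep vertex.** Under `RatioAtDepth R₀ k`, at an `R₀`-deep vertex `v ∈ Λ`
of a simply connected domain with a boundary root, every port of a labelled star is pinned to the
monopole: `3‖Fⱼ‖ ≤ (1+k)‖M‖` and `(1-k)‖M‖ ≤ 3‖Fⱼ‖`. -/
theorem port_bounds_of_star {k R₀ : ℝ} (hR : RatioAtDepth R₀ k) {Λ : Finset HexVertex}
    {a : Sym2 HexVertex} {v w₀ w₁ w₂ : HexVertex} (hΛ : hexDomainSimplyConnected Λ)
    (ha : a ∈ hexDomainBoundary Λ) (hv : v ∈ Λ) (hdeep : Deep Λ v R₀) (h₀ : hexGraph.Adj v w₀)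
    (h₁ : hexGraph.Adj v w₁) (h₂ : hexGraph.Adj v w₂) (h01 : w₀ ≠ w₁) (h12 : w₁ ≠ w₂)
    (h02 : w₀ ≠ w₂) :
    (3 * ‖obs Λ a s(v, w₀)‖ ≤ (1 + k) * ‖fieldMono (obs Λ a) v w₀ w₁ w₂‖ ∧
      3 * ‖obs Λ a s(v, w₁)‖ ≤ (1 + k) * ‖fieldMono (obs Λ a) v w₀ w₁ w₂‖ ∧
      3 * ‖obs Λ a s(v, w₂)‖ ≤ (1 + k) * ‖fieldMono (obs Λ a) v w₀ w₁ w₂‖) ∧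
    ((1 - k) * ‖fieldMono (obs Λ a) v w₀ w₁ w₂‖ ≤ 3 * ‖obs Λ a s(v, w₀)‖ ∧
      (1 - k) * ‖fieldMono (obs Λ a) v w₀ w₁ w₂‖ ≤ 3 * ‖obs Λ a s(v, w₁)‖ ∧
      (1 - k) * ‖fieldMono (obs Λ a) v w₀ w₁ w₂‖ ≤ 3 * ‖obs Λ a s(v, w₂)‖) := by
  rcases belt_eq_zero_or hΛ ha hv h₀ h₁ h₂ h01 h12 h02 with hD | hD
  · exact modes_bounds (obs Λ a) v w₀ w₁ w₂ k hD
      (hR Λ hΛ a ha v hv hdeep w₀ w₂ w₁ h₀ h₂ h₁ h02 h12.symm h01)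
  · have h := modes_bounds (obs Λ a) v w₀ w₂ w₁ k hD
      (hR Λ hΛ a ha v hv hdeep w₀ w₁ w₂ h₀ h₁ h₂ h01 h12 h02)
    have hM : fieldMono (obs Λ a) v w₀ w₂ w₁ = fieldMono (obs Λ a) v w₀ w₁ w₂ := by
      simp only [fieldMono]; ring
    rw [hM] at h
    exact ⟨⟨h.1.1, h.1.2.2, h.1.2.1⟩, ⟨h.2.1, h.2.2.2, h.2.2.1⟩⟩

/-- **Two-port Harnack inequality**: any two ports at a deep vertex compare with the constant
`K = (1+k)/(1-k)`. -/
theorem norm_port_le_of_adj {k R₀ : ℝ} (hk0 : 0 ≤ k) (hk1 : k < 1) (hR : RatioAtDepth R₀ k)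
    {Λ : Finset HexVertex} {a : Sym2 HexVertex} {v q q' : HexVertex}
    (hΛ : hexDomainSimplyConnected Λ) (ha : a ∈ hexDomainBoundary Λ) (hv : v ∈ Λ)
    (hdeep : Deep Λ v R₀) (hq : hexGraph.Adj v q) (hq' : hexGraph.Adj v q') :
    ‖obs Λ a s(v, q)‖ ≤ (1 + k) / (1 - k) * ‖obs Λ a s(v, q')‖ := by
  have h1k : 0 < 1 - k := by linarith
  have hK1 : 1 ≤ (1 + k) / (1 - k) := by rw [le_div_iff₀ h1k]; linarith
  by_cases hqq : q' = q
  · subst hqq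
    calc ‖obs Λ a s(v, q')‖ = 1 * ‖obs Λ a s(v, q')‖ := (one_mul _).symm
      _ ≤ (1 + k) / (1 - k) * ‖obs Λ a s(v, q')‖ :=
        mul_le_mul_of_nonneg_right hK1 (norm_nonneg _)
  obtain ⟨q₁, q₂, hq₁, hq₂, h01, h12, h02, hall⟩ := star_cases hq
  obtain ⟨hup, hlow⟩ := port_bounds_of_star hR hΛ ha hv hdeep hq hq₁ hq₂ h01 h12 h02
  set M := fieldMono (obs Λ a) v q q₁ q₂
  have hlow' : (1 - k) * ‖M‖ ≤ 3 * ‖obs Λ a s(v, q')‖ := by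
    rcases hall q' hq' with rfl | rfl | rfl
    · exact absurd rfl hqq
    · exact hlow.2.1
    · exact hlow.2.2
  rw [div_mul_eq_mul_div, le_div_iff₀ h1k]
  nlinarith [hup.1, hlow', norm_nonneg M, norm_nonneg (obs Λ a s(v, q))]

/-! ### The star of the origin vertex -/

/-- `O ∼ A`. -/
theorem adj_O_nbA : hexGraph.Adj O nbA := (hexGraph_adj_iff_of_snd_eq_zero_holds 0 0).2 (Or.inl rfl)

/-- `O ∼ B`. -/
theorem adj_O_nbB : hexGraph.Adj O nbB :=
  (hexGraph_adj_iff_of_snd_eq_zero_holds 0 _).2 (Or.inr (Or.inl (zero_sub _).symm))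

/-- `O ∼ C`. -/
theorem adj_O_nbC : hexGraph.Adj O nbC :=
  (hexGraph_adj_iff_of_snd_eq_zero_holds 0 _).2 (Or.inr (Or.inr (zero_sub _).symm))

/-- `e₀ ≠ 0`, `e₁ ≠ 0`, `e₀ ≠ e₁` in `ℤ²`. -/
theorem single_facts : (Pi.single 0 1 : Site 2) ≠ 0 ∧ (Pi.single 1 1 : Site 2) ≠ 0 ∧
    (Pi.single 0 1 : Site 2) ≠ Pi.single 1 1 := by
  refine ⟨fun h => ?_, fun h => ?_, fun h => ?_⟩
  · have := congrFun h 0; simp at this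
  · have := congrFun h 1; simp at this
  · have := congrFun h 0; simp at this

/-- `A ≠ B`. -/
theorem nbA_ne_nbB : nbA ≠ nbB := fun h => by
  have h1 := (Prod.mk.inj h).1
  exact single_facts.1 (neg_eq_zero.1 h1.symm)

/-- `B ≠ C`. -/
theorem nbB_ne_nbC : nbB ≠ nbC := fun h => by
  have h1 := (Prod.mk.inj h).1
  exact single_facts.2.2 (neg_injective h1)

/-- `A ≠ C`. -/
theorem nbA_ne_nbC : nbA ≠ nbC := fun h => by
  have h1 := (Prod.mk.inj h).1
  exact single_facts.2.1 (neg_eq_zero.1 h1.symm)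

/-- The three neighbours of `O` are `A, B, C`. -/
theorem nbr_cases {w : HexVertex} (h : hexGraph.Adj O w) : w = nbA ∨ w = nbB ∨ w = nbC := by
  obtain ⟨y, l⟩ := w
  fin_cases l
  · exact absurd h (not_hexGraph_adj_of_snd_eq_holds _ _ rfl)
  · rcases (hexGraph_adj_iff_of_snd_eq_zero_holds 0 y).1 h with rfl | rfl | rfl
    · exact Or.inl rfl
    · refine Or.inr (Or.inl ?_); simp [nbB]
    · refine Or.inr (Or.inr ?_); simp [nbC]

/-- **The ports of `O` are bounded by the monopole `M(O)`** at an `R₀`-deep origin: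
`‖F{O,q}‖ ≤ ‖M(O)‖` (indeed `≤ (1+k)/3 ‖M(O)‖`). -/
theorem norm_port_O_le {k R₀ : ℝ} (hk1 : k < 1) (hR : RatioAtDepth R₀ k)
    {Λ : Finset HexVertex} {a : Sym2 HexVertex} (hΛ : hexDomainSimplyConnected Λ)
    (ha : a ∈ hexDomainBoundary Λ) (hO : O ∈ Λ) (hdeep : Deep Λ O R₀) {q : HexVertex}
    (hq : hexGraph.Adj O q) : ‖obs Λ a s(O, q)‖ ≤ ‖obsMono Λ a‖ := by
  obtain ⟨hup, -⟩ := port_bounds_of_star hR hΛ ha hO hdeep adj_O_nbA adj_O_nbB adj_O_nbC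
    nbA_ne_nbB nbB_ne_nbC nbA_ne_nbC
  have hM : fieldMono (obs Λ a) O nbA nbB nbC = obsMono Λ a := rfl
  rw [hM] at hup
  have h3 : 3 * ‖obs Λ a s(O, q)‖ ≤ (1 + k) * ‖obsMono Λ a‖ := by
    rcases nbr_cases hq with rfl | rfl | rfl
    · exact hup.1
    · exact hup.2.1
    · exact hup.2.2
  nlinarith [h3, norm_nonneg (obsMono Λ a), norm_nonneg (obs Λ a s(O, q))]

/-! ### Chaining along a lattice walk from `O` -/

/-- `Deep` is antitone in the radius. -/
theorem deep_anti {Λ : Finset HexVertex} {v : HexVertex} {R R' : ℝ} (h : Deep Λ v R)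
    (hle : R' ≤ R) : Deep Λ v R' := fun w hw => h w (hw.trans hle)

/-- **Lattice Harnack chain.** Along a lattice walk from `p` to `O` staying within distance `D`
of `c_O`, in a configuration that is `(D + R₀)`-deep at `O`, every port at `p` is at most
`K^{length} ‖M(O)‖`, `K = (1+k)/(1-k)`. -/
theorem harnack_walk {k R₀ : ℝ} (hk0 : 0 ≤ k) (hk1 : k < 1) (hR : RatioAtDepth R₀ k)
    (hR0 : 0 ≤ R₀) : ∀ {p : HexVertex} (W : hexGraph.Walk p O) (D : ℝ),
      (∀ u ∈ W.support, dist (hexCenter u) (hexCenter O) ≤ D) →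
      ∀ (Λ : Finset HexVertex) (a : Sym2 HexVertex), hexDomainSimplyConnected Λ →
        a ∈ hexDomainBoundary Λ → Deep Λ O (D + R₀) → ∀ q : HexVertex, hexGraph.Adj p q →
          ‖obs Λ a s(p, q)‖ ≤ ((1 + k) / (1 - k)) ^ W.length * ‖obsMono Λ a‖
  | _, SimpleGraph.Walk.nil, D, hD, Λ, a, hΛ, ha, hdeep, q, hq => by
    have hD0 : 0 ≤ D := by
      have := hD O (by simp)
      rwa [dist_self] at this
    have hO : O ∈ Λ := hdeep O (by rw [dist_self]; linarith)
    have hdeepO : Deep Λ O R₀ := deep_anti hdeep (by linarith)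
    rw [SimpleGraph.Walk.length_nil, pow_zero, one_mul]
    exact norm_port_O_le hk1 hR hΛ ha hO hdeepO hq
  | p, SimpleGraph.Walk.cons (v := p') h W', D, hD, Λ, a, hΛ, ha, hdeep, q, hq => by
    have hsupp : ∀ u ∈ W'.support, dist (hexCenter u) (hexCenter O) ≤ D := fun u hu =>
      hD u (by rw [SimpleGraph.Walk.support_cons]; exact List.mem_cons_of_mem _ hu)
    have hp : dist (hexCenter p) (hexCenter O) ≤ D := hD p (by simp)
    have ih := harnack_walk hk0 hk1 hR hR0 W' D hsupp Λ a hΛ ha hdeep p h.symm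
    rw [Sym2.eq_swap] at ih
    have hpΛ : p ∈ Λ := hdeep p (by linarith)
    have hdeepP : Deep Λ p R₀ := fun w hw => hdeep w (by
      linarith [dist_triangle (hexCenter w) (hexCenter p) (hexCenter O)])
    have step := norm_port_le_of_adj hk0 hk1 hR hΛ ha hpΛ hdeepP hq h
    have h1k : 0 < 1 - k := by linarith
    have hK0 : 0 ≤ (1 + k) / (1 - k) := div_nonneg (by linarith) h1k.le
    rw [SimpleGraph.Walk.length_cons, pow_succ]
    calc ‖obs Λ a s(p, q)‖ ≤ (1 + k) / (1 - k) * ‖obs Λ a s(p, p')‖ := step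
      _ ≤ (1 + k) / (1 - k) * (((1 + k) / (1 - k)) ^ W'.length * ‖obsMono Λ a‖) :=
        mul_le_mul_of_nonneg_left ih hK0
      _ = ((1 + k) / (1 - k)) ^ W'.length * ((1 + k) / (1 - k)) * ‖obsMono Λ a‖ := by ring

/-- **Lattice Harnack bound, edge by edge.** Under `RatioAtDepth R₀ k` (`0 ≤ k < 1`, `0 ≤ R₀`),
for every edge `z` of `ℍ` there are `C` and `N` such that `‖F(z)‖ ≤ C ‖M(O)‖` for every simply
connected `Λ` with a boundary root that is `n`-deep at `O`, `n ≥ N`. -/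
theorem harnack_edge {k R₀ : ℝ} (hk0 : 0 ≤ k) (hk1 : k < 1) (hR : RatioAtDepth R₀ k)
    (hR0 : 0 ≤ R₀) {z : Sym2 HexVertex} (hz : z ∈ hexGraph.edgeSet) :
    ∃ (C : ℝ) (N : ℕ), ∀ (Λ : Finset HexVertex) (a : Sym2 HexVertex) (n : ℕ),
      hexDomainSimplyConnected Λ → a ∈ hexDomainBoundary Λ → Deep Λ O n → N ≤ n →
        ‖obs Λ a z‖ ≤ C * ‖obsMono Λ a‖ := by
  induction z using Sym2.ind with
  | h p q =>
    have hpq : hexGraph.Adj p q := (SimpleGraph.mem_edgeSet _).1 hz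
    obtain ⟨W, hW⟩ := ObservableToSLE.FloorRatio.exists_walk_dist_le_dist p O
    set D := dist (hexCenter p) (hexCenter O)
    refine ⟨((1 + k) / (1 - k)) ^ W.length, ⌈D + R₀⌉₊, fun Λ a n hΛ ha hdeep hn => ?_⟩
    refine harnack_walk hk0 hk1 hR hR0 W D hW Λ a hΛ ha (deep_anti hdeep ?_) q hpq
    calc D + R₀ ≤ ⌈D + R₀⌉₊ := Nat.le_ceil _
      _ ≤ n := by exact_mod_cast hn

/-- **Registered sub-goal** (crux item stmt-CriticalPhenomena-8297, line `liouville-local-limits`,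
helper for `stub_compactnessAtOrigin`): the edge-by-edge lattice Harnack bound under bulk no-fold,
registry form of `harnack_edge`. -/
theorem harnack_edge_bound :
    ∀ (k R₀ : ℝ), 0 ≤ k → k < 1 → RatioAtDepth R₀ k → 0 ≤ R₀ → ∀ z ∈ hexGraph.edgeSet,
      ∃ (C : ℝ) (N : ℕ), ∀ (Λ : Finset HexVertex) (a : Sym2 HexVertex) (n : ℕ),
        hexDomainSimplyConnected Λ → a ∈ hexDomainBoundary Λ → Deep Λ O n → N ≤ n →
          ‖obs Λ a z‖ ≤ C * ‖obsMono Λ a‖ := by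
  intro k R₀ hk0 hk1 hR hR0 z hz
  exact harnack_edge hk0 hk1 hR hR0 hz

end Summit.CriticalPhenomena.SAWScalingLimit.Theorems.InteriorFlattening.Liouville.Compactness

end
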